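import Literature.MathematicalPhysics.QuantumFieldTheory.QCDTransferMatrix

/-!
# Dictionary: the spin-blind and the colour-blind lifts of `wilson_det_transfer_form` are `sliceKron`s
(crux `QuarksAsStableAction.StableActionBridge`, item stmt-QuantumFields-9737, line `Sketch`;
registered stubs `sliceKron_one_spin_apply` and `sliceKron_spinDiag_apply` of the lead skeleton)

The landed Wilson-determinant transfer form (`wilson_det_transfer_form`) works on the index
`TorusSite 3 L × Fin 3 × Fin 4` (site `x`, colour `a`, spin `α`) of one time slice and uses two
explicit `Matrix.of` lifts:

* the colour-blind lift of a `4 × 4` spin matrix `S` (the projectors `P^±`),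
  `fun a b => if a.1 = b.1 ∧ a.2.1 = b.2.1 then S a.2.2 b.2.2 else 0`, i.e. `1 ⊗ S`;
* the spin-diagonal lift of a spin-blind matrix `B` on `TorusSite 3 L × Fin 3`,
  `fun a b => if a.2.2 = b.2.2 then B (a.1, a.2.1) (b.1, b.2.1) else 0`, i.e. `B ⊗ 1₄`.

Smit's transfer-matrix vocabulary (`QCDTransferMatrix.lean`) expresses both through

  `sliceKron B Γ := Matrix.of fun p q => B (p.1, p.2.1, p.2.2.1) (q.1, q.2.1, q.2.2.1) * Γ p.2.2.2 q.2.2.2`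

on `SliceQuarkVar Nf S = Fin Nf × (TorusSite 3 S × Fin 3 × Fin 4)`, `B` living on
`SliceColourVar Nf S = Fin Nf × (TorusSite 3 S × Fin 3)` (Smit, *Introduction to Quantum Fields
on a Lattice*, §6.5 (6.74)–(6.77): `A = A_red ⊗ 1₄`, `P^± = 1 ⊗ (1 ± γ₄)/2`).  This file records
the two dictionary entries for one flavour (`Nf = 1`, flavour component `0 : Fin 1`):
`sliceKron 1 S` is the colour-blind lift and `sliceKron B 1` is the spin-diagonal lift, entry by
entry.  Both proofs are definitional unfolding of `sliceKron` and `Matrix.one_apply` followed by a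
case split on the Kronecker deltas.

[cite: Smit2023, §6.5 (6.74)–(6.77)]
-/

noncomputable section

open MeasureTheory Matrix Literature.MathematicalPhysics.QuantumFieldTheory
  Literature.MathematicalPhysics.QuantumLattice
open Literature.Probability.LatticeModels (TorusSite)

namespace Summit.QuantumFields.QCD.Cruxes.StableActionBridge.Sketch

/-- **Dictionary entry `1 ⊗ S`.**  For one flavour, Smit's `sliceKron 1 S` of a `4 × 4` spin
matrix `S` is, entry by entry, the colour-blind lift `δ_{x,x'} δ_{a,a'} S_{α α'}` used for the
projectors `P^±` in the Wilson-determinant transfer form (site `x`, colour `a`, spin `α`).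
[cite: Smit2023, §6.5 (6.77)] -/
theorem sliceKron_one_spin_apply : ∀ (L : ℕ) [NeZero L] (Sm : Matrix (Fin 4) (Fin 4) ℂ) (p q : TorusSite 3 L × Fin 3 × Fin 4), sliceKron (Nf := 1) (S := L) 1 Sm (0, p) (0, q) = (if p.1 = q.1 ∧ p.2.1 = q.2.1 then Sm p.2.2 q.2.2 else 0) := by
  intro L _ Sm p q
  simp only [sliceKron, Matrix.of_apply, Matrix.one_apply, Prod.mk.injEq, true_and, ite_mul,
    one_mul, zero_mul]

/-- **Dictionary entry `B ⊗ 1₄`.**  For one flavour, Smit's `sliceKron B 1` of a spin-blind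
matrix `B` is, entry by entry, the spin-diagonal lift `δ_{α,α'} B_{(x,a),(x',a')}` used for
`A = A_red ⊗ 1₄` in the Wilson-determinant transfer form (site `x`, colour `a`, spin `α`).
[cite: Smit2023, §6.5 (6.74)] -/
theorem sliceKron_spinDiag_apply : ∀ (L : ℕ) [NeZero L] (B : Matrix (SliceColourVar 1 L) (SliceColourVar 1 L) ℂ) (p q : TorusSite 3 L × Fin 3 × Fin 4), sliceKron (Nf := 1) (S := L) B 1 (0, p) (0, q) = (if p.2.2 = q.2.2 then B (0, (p.1, p.2.1)) (0, (q.1, q.2.1)) else 0) := by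
  intro L _ B p q
  simp only [sliceKron, Matrix.of_apply, Matrix.one_apply, mul_ite, mul_one, mul_zero]

end Summit.QuantumFields.QCD.Cruxes.StableActionBridge.Sketch

end
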